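import Summits.ResolutionOfSingularities.ResolutionOfSingularities.Theorems.AbhyankarShadowsShadowsUniformizeComposite
import Summits.ResolutionOfSingularities.ResolutionOfSingularities.Theorems.AbhyankarShadowsShadowsUniformizeCompositeResidueDiscrete
import Summits.ResolutionOfSingularities.ResolutionOfSingularities.Theorems.AbhyankarShadowsShadowsUniformizeResidueGen
import Summits.ResolutionOfSingularities.ResolutionOfSingularities.Theorems.AbhyankarShadowsShadowsUniformizeLurelDenseAbhyankar
import Literature.AlgebraicGeometry.Resolution.LocalUniformizationAbhyankarPlaces
import HarnessLib

/-!
# Relative local uniformization at composite rational places with a discrete residue valuation: the composite-discrete branch of `ShadowsUniformize`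

Composite-discrete branch of the birth line of the crux `ShadowsUniformize` (route
`AbhyankarShadows`, item stmt-ResolutionOfSingularities-16756), lead c2 (reshape #3): the typed
assembly `lurelRational_of_isCompositeDiscrete`.

**Theorem.** Let `k` be algebraically closed of characteristic `p`, `K/k` finitely generated,
`O ∋ k` a RATIONAL valuation ring of `K` (`κ(O) = k`), and suppose `O` has a coarsening `O₁ ⊇ O`
which is an Abhyankar place of `K/k` — or lies in the completion of an Abhyankar subfunction field
(Knaf–Kuhlmann 2009, Thm. 1.5) — such that the residue valuation `ν₂` of `ν_O = ν_{O₁} ∘ ν₂`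
(ring `O / 𝔪_{O₁} ⊆ κ(O₁)`, `residueValuationSubring`) has CYCLIC value group. Then every finitely
generated `R ⊆ O` is dominated by a finitely generated `A ⊆ O` with `Frac A = K` regular at the
centre of `O`. Example (transcendence degree `3`): value group `ℤ²` (lex), `ν₁` a prime divisor
of `K`, `ν₂` a discrete rational non-Abhyankar place of the residue function field `κ(O₁)` of
transcendence degree `2` — `O` is neither Abhyankar nor discrete.

Proof: the per-valuation form of Novacoski–Spivakovsky's composition (`stub_lurel_of_composite`,
landed: Cor. 2.14, Cor. 2.17, §3.1) with (i) relative local uniformization of the coarsening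
(`relLU_at_abhyankarPlace_of_perfectField`, Knaf–Kuhlmann 2005 Thm. 1.1, resp.
`lurelRational_of_isDenseAbhyankar`, Knaf–Kuhlmann 2009 Thm. 1.5), (ii) finite generation of
`κ(O₁)` by residues of elements of `O` (`stub_residue_gen_unfolded`, Knaf–Kuhlmann 2005 Cor. 2.2),
(iii) relative local uniformization of the discrete rational residue valuation through the
`k`-isomorphism `κ ≅ κ(O₁)` (`stub_composite_residue_discrete`, from
`lurelRational_of_isCyclic_valueGroup`).

## Sources

* J. Novacoski, M. Spivakovsky, *Reduction of local uniformization to the rank one case*,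
  EMS Ser. Congr. Rep. (2014) = arXiv:1204.4751: Thm. 1.1, §3.1. [NovacoskiSpivakovsky2014]
* H. Knaf, F.-V. Kuhlmann, Ann. Sci. ÉNS 38 (2005): Thm. 1.1, Cor. 2.2 [KnafKuhlmann2005];
  Adv. Math. 221 (2009): Thm. 1.5 [KnafKuhlmann2009].
-/

noncomputable section

-- single-problem summit: the doubled namespace component is forced
set_option linter.dupNamespace false

open Literature.AlgebraicGeometry.Resolution IsLocalRing

namespace Summit.ResolutionOfSingularities.ResolutionOfSingularities.Theorems

/-- **Relative local uniformization at composite rational places `ν = ν₁ ∘ ν₂` with `ν₁`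
Abhyankar or dense-Abhyankar and `ν₂` discrete** (typed, in the vocabulary of the crux
`ShadowsUniformize` / the target `LurelRational`): for `k` algebraically closed of characteristic
`p`, `K/k` finitely generated, `O ∋ k` a rational valuation ring of `K` with a coarsening `O₁ ⊇ O`
that is an Abhyankar place of `K/k` or lies in the completion of a finitely generated Abhyankar
subextension, and whose residue valuation ring `O / 𝔪_{O₁}` has cyclic value group, every finitely
generated `R ⊆ O` is dominated by a finitely generated `A ⊆ O`, `Frac A = K`, regular at the
centre of `O`. (Novacoski–Spivakovsky composition of the landed branches.)
[cite: NovacoskiSpivakovsky2014, Thm. 1.1] -/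
theorem lurelRational_of_isCompositeDiscrete :
    ∀ p : ℕ, p.Prime → ∀ (k K : Type) [Field k] [CharP k p] [IsAlgClosed k] [Field K]
      [Algebra k K], (⊤ : IntermediateField k K).FG → ∀ O : ValuationSubring K,
      (∀ c : k, algebraMap k K c ∈ O) →
      (∀ x : K, x ∈ O → ∃ c : k, O.valuation (x - algebraMap k K c) < 1) →
      (∃ (O₁ : ValuationSubring K) (hO : O ≤ O₁),
        (IsAbhyankarPlace O₁ (algebraMap k K).fieldRange ⊤ ∨
          ∃ K₀ : IntermediateField k K, K₀.FG ∧
            IsAbhyankarPlace O₁ (algebraMap k K).fieldRange K₀.toSubfield ∧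
              IsDenseIn O₁ K₀.toSubfield ⊤) ∧
        IsCyclic ((residueValuationSubring O O₁ hO).ValueGroup)ˣ) →
      ∀ R : Subalgebra k K, R.FG → R.toSubring ≤ O.toSubring →
      ∃ (A : Subalgebra k K) (h : A.toSubring ≤ O.toSubring), R ≤ A ∧ A.FG ∧
        IsFractionRing A K ∧ IsRegularLocalRing
          (Localization.AtPrime (Ideal.comap (Subring.inclusion h) (IsLocalRing.maximalIdeal O))) := by
  intro p hp k K _ _ _ _ _ hfg O hk hrat hC R hR hRO
  obtain ⟨O₁, hO, hA₁, hcyc⟩ := hC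
  have hk₁ : ∀ c : k, algebraMap k K c ∈ O₁ := fun c => hO (hk c)
  -- (i) relative local uniformization of the coarsening
  have hLU₁ : ∀ R : Subalgebra k K, R.FG → R.toSubring ≤ O₁.toSubring →
      ∃ (A : Subalgebra k K) (h : A.toSubring ≤ O₁.toSubring), R ≤ A ∧ A.FG ∧
        IsFractionRing A K ∧ IsRegularLocalRing
          (Localization.AtPrime (Ideal.comap (Subring.inclusion h) (IsLocalRing.maximalIdeal O₁))) := by
    intro R' hR' hR'O
    rcases hA₁ with hA₁ | hD₁
    · exact relLU_at_abhyankarPlace_of_perfectField hfg O₁ hk₁ hA₁ R' hR' hR'O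
    · exact lurelRational_of_isDenseAbhyankar p hp k K hfg O₁ hk₁ hD₁ R' hR' hR'O
  -- (ii) the residue field of the coarsening is generated by residues of elements of `O`
  have hgen := stub_residue_gen_unfolded k K hfg O O₁ hO hk hA₁
  -- (iii) the discrete residue valuation, and the composition
  exact stub_lurel_of_composite k K hfg O O₁ hO hk hgen hLU₁
    (fun κ _ _ ι hι hιk =>
      stub_composite_residue_discrete p hp k K O O₁ hO hk hrat hgen hcyc κ ι hι hιk) R hR hRO

end Summit.ResolutionOfSingularities.ResolutionOfSingularities.Theorems

end
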